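import Literature.Geometry.Kaehler.ComplexTorusAnalyticFibreFormula
import HarnessLib

/-!
# The weighted fibre formula for the analytic cycle class of a product torus

Layer `Literature/Geometry/Kaehler`, namespace `Literature.Geometry.Kaehler.ComplexTorus`; lane
`lit-hodgefound`, seat p07, programme «THE GENERIC FIBRE CLASS IS THE RESTRICTION OF THE CLASS, AND THE
MOVING LEMMA ON A COMPLEX TORUS», file 1 (sequel of `ComplexTorusAnalyticFibreFormula.lean`, whose
`analyticCyclePeriod_cross_eq_integral_fibreSlice` is the unweighted case over a period box).

**Theorem (`ComplexTorus.setIntegral_weight_cross_eq_integral_fibreSlice`).** Let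
`X = X₁ × X₂ = (E₁ ⊞ E₂)/(Λ₁ ⊕ Λ₂)` be the Euclidean product torus (`prodPeriodL2 Φ₁ Φ₂`), `Z ⊆ X`
analytic of pure dimension `q + dim E₂` with `0 < q`, `γ` an invariant `2q`-form of `X₁`, `ν` an
invariant form of `X₂` of top degree `2 dim E₂`, and `g : E₂ → ℂ` a bounded measurable WEIGHT vanishing
off a bounded set. Then, over the slab `D = Φ₁([0,1)^ι₁) × E₂` (a fundamental domain of `Λ₁ ⊕ 0`),
`∫_{reg π⁻¹Z ∩ D} g(z₂) (pr₁^*γ ∧ pr₂^*ν)(ξ(z)) d𝓗^{2q + 2 dim E₂}(z)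
   = ν(e₂, ie₂, …) · ∫_{t ∈ E₂} g(t) (∫_{Z_t} γ) d𝓗^{2 dim E₂}(t)`,
where `Z_t = {x̄ ∈ X₁ | (x̄, π₂ t) ∈ Z}` is the slice, for a.e. `t` empty (contributing `0`) or of pure
dimension `q` (`ComplexTorus.ae_hasPureDim_fibreSlice`), and `∫_{Z_t} γ = analyticCyclePeriod Φ₁ _ γ`;
moreover `t ↦ g(t) ∫_{Z_t} γ` is integrable (`ComplexTorus.integrable_weight_mul_fibreSlicePeriod`, when
`ν(e₂, ie₂, …) ≠ 0` is available as a normalisation, e.g. for a volume form), and `t ↦ ∫_{Z_t} γ` is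
a.e. strongly measurable (`ComplexTorus.aestronglyMeasurable_fibreSlicePeriod`).

This is the coarea formula [Federer1969, 3.2.22] `∫_A (g ∘ pr₂) Ω = ∫_t g(t) ∫_{A_t} Ω_t dt` for the
projection `pr₂` restricted to the regular locus of `π⁻¹Z`, organised exactly as in the unweighted file:
the carrier splits into the part critical for `pr₂`, on which the integrand vanishes identically
(`HolomorphicChain.cross_apply_orientationFrame_eq_zero_of_critical`), and countably many disjoint
measurable pieces of holomorphic sheets ADAPTED to `pr₂` (`exists_adapted_section_of_finrank_eq`), on each
of which the local coarea formula `HolomorphicChain.integral_image_section_cross_eq` (which carries an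
arbitrary weight) applies with the weight `g ∘ pr₂`, constant along the fibres of the adapted sections;
summing and identifying the fibre terms for a.e. `t` with the period of the slice chain
(`HolomorphicChain.integral_image_section_eq`, `isRegPt_slice_of_nonCritical`) gives the formula. In the
language of currents it is the slicing identity `⟨[Z], pr₂, t⟩ = [Z_t]` for almost all `t` of the
integration current of an analytic set by a holomorphic map [King1971, §3], [Federer1969, 4.3.2], tested
against `pr₁^*γ`. It is the input of the constancy of the generic fibre class (Fulton's "`α_t = i_t^*α`",
[Fulton1998, §10.1 Example 10.1.2]) in `ComplexTorusAnalyticFibreClassConstant.lean`.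

Theorems only; no definitions, no named facts.

## References

* [Federer1969] H. Federer, *Geometric Measure Theory*, Springer 1969, 3.2.22 (coarea formula), 3.2.5,
  4.3.2 (slicing).
* [King1971] J. R. King, *The currents defined by analytic varieties*, Acta Math. 127 (1971) 185–220, §3.
* [Chirka1989] E. M. Chirka, *Complex Analytic Sets*, Kluwer 1989, §2.3, A2.2, §14.1 Cor. p. 174.
* [Fulton1998] W. Fulton, *Intersection Theory*, 2nd ed., Springer 1998, §10.1 (Example 10.1.2).
* [VoisinHodgeI2002] C. Voisin, *Hodge Theory and Complex Algebraic Geometry I*, CUP 2002, §11.1.2.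
-/

noncomputable section

open scoped Manifold Topology ENNReal NNReal
open MeasureTheory MeasureTheory.Measure Set Function Filter Module TopologicalSpace WithLp
open Literature.Geometry.GeometricMeasureTheory Literature.Analysis.Complex

universe u

namespace Literature.Geometry.Kaehler

namespace ComplexTorus

section Window

/-- **The integrand of the period functional is integrable on every bounded window**: for `Z ⊆ X`
analytic of pure dimension `d` and an invariant `2d`-form `ω`, `z ↦ ω(ξ(z))` is `𝓗^{2d}`-integrable on
`reg π⁻¹Z ∩ B` for every bounded measurable `B` (Lelong's local finiteness of the volume of analytic sets,
on the compact closure of `B`). [cite: Chirka1989, §14.1 Cor., p. 174; VoisinHodgeI2002, §11.1.2 Cor. 11.15] -/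
theorem integrableOn_apply_orientationFrame_carrier_inter_of_isBounded {ι : Type*} [Fintype ι]
    {E : Type u} [NormedAddCommGroup E] [InnerProductSpace ℂ E] [FiniteDimensional ℂ E]
    [MeasurableSpace E] [BorelSpace E] (Φ : (ι → ℝ) ≃L[ℝ] E) {d : ℕ} {Z : Set (ComplexTorus Φ)}
    (hZ : HasPureDim 𝓘(ℂ, E) Z d) (ω : E [⋀^Fin (2 * d)]→L[ℝ] ℂ) {B : Set E} (hB : Bornology.IsBounded B)
    (hBm : MeasurableSet B) :
    IntegrableOn (fun z ↦ ω ((analyticChain Φ hZ).orientationFrame z))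
      ((analyticChain Φ hZ).carrier ∩ B) (μHE[2 * d] : Measure E) := by
  have hK : IsCompact (closure B) := hB.isCompact_closure
  have h := (analyticChain Φ hZ).integrableOn_constIntegrand
    ((analyticChain Φ hZ).integrableOn_density_smul_frameVector_of_subset_isCompact subset_closure hK
      (fun _ _ ↦ trivial)) ω
  rw [IntegrableOn, Measure.restrict_restrict hBm, inter_comm] at h
  refine IntegrableOn.congr_fun h (fun z hz ↦ ?_) ((analyticChain Φ hZ).measurableSet_carrier.inter hBm)
  rw [show (analyticChain Φ hZ).density z = 1 from HolomorphicChain.density_ofSet_of_mem_carrier _ hz.1]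
  simp

end Window

section Fibre

variable {ι₁ ι₂ : Type*} [Fintype ι₁] [Fintype ι₂]
  {E₁ : Type u} [NormedAddCommGroup E₁] [InnerProductSpace ℂ E₁] [FiniteDimensional ℂ E₁]
  [MeasurableSpace E₁] [BorelSpace E₁]
  {E₂ : Type u} [NormedAddCommGroup E₂] [InnerProductSpace ℂ E₂] [FiniteDimensional ℂ E₂]
  [MeasurableSpace E₂] [BorelSpace E₂]
  (Φ₁ : (ι₁ → ℝ) ≃L[ℝ] E₁) (Φ₂ : (ι₂ → ℝ) ≃L[ℝ] E₂)

omit [Fintype ι₁] [FiniteDimensional ℂ E₁] [MeasurableSpace E₁] [BorelSpace E₁] [MeasurableSpace E₂]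
  [BorelSpace E₂] in
/-- The window `{z | z₁ ∈ Φ₁([0,1)^ι₁), ‖z₂‖ ≤ R}` of `E₁ ⊞ E₂` is bounded (it lies in the preimage of the
compact `Φ₁([0,1]^ι₁) × B̄(0, R)`). [cite: Lange2023AbelianVarietiesComplex, §1.1.1] -/
theorem isBounded_slabWindow (R : ℝ) :
    Bornology.IsBounded {z : WithLp 2 (E₁ × E₂) | (ofLp z).1 ∈ periodBox Φ₁ 0 ∧ ‖(ofLp z).2‖ ≤ R} := by
  haveI : ProperSpace E₂ := FiniteDimensional.proper_rclike ℂ E₂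
  have hK : IsCompact ((WithLp.prodContinuousLinearEquiv 2 ℝ E₁ E₂ : WithLp 2 (E₁ × E₂) → E₁ × E₂) ⁻¹'
      (closedPeriodBox Φ₁ 0 ×ˢ Metric.closedBall (0 : E₂) R)) :=
    ((WithLp.prodContinuousLinearEquiv 2 ℝ E₁ E₂).toHomeomorph.isCompact_preimage).2
      ((isCompact_closedPeriodBox Φ₁ 0).prod (isCompact_closedBall (0 : E₂) R))
  refine hK.isBounded.subset ?_
  rintro z ⟨hz1, hz2⟩
  exact ⟨periodBox_subset_closedPeriodBox Φ₁ 0 hz1, mem_closedBall_zero_iff.2 hz2⟩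

omit [FiniteDimensional ℂ E₁] in
/-- The window `{z | z₁ ∈ Φ₁([0,1)^ι₁), ‖z₂‖ ≤ R}` is measurable. [cite: Lange2023AbelianVarietiesComplex, §1.1.1] -/
theorem measurableSet_slabWindow (R : ℝ) :
    MeasurableSet {z : WithLp 2 (E₁ × E₂) | (ofLp z).1 ∈ periodBox Φ₁ 0 ∧ ‖(ofLp z).2‖ ≤ R} := by
  have h1 : MeasurableSet {z : WithLp 2 (E₁ × E₂) | (ofLp z).1 ∈ periodBox Φ₁ 0} :=
    (measurableSet_periodBox Φ₁ 0).preimage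
      (continuous_fst.comp (WithLp.prod_continuous_ofLp 2 E₁ E₂)).measurable
  have h2 : MeasurableSet {z : WithLp 2 (E₁ × E₂) | ‖(ofLp z).2‖ ≤ R} :=
    (isClosed_le ((continuous_norm.comp (continuous_snd.comp (WithLp.prod_continuous_ofLp 2 E₁ E₂))))
      continuous_const).measurableSet
  exact h1.inter h2

omit [FiniteDimensional ℂ E₁] in
/-- The slab `{z | z₁ ∈ Φ₁([0,1)^ι₁)}` is measurable. [cite: Lange2023AbelianVarietiesComplex, §1.1.1] -/
theorem measurableSet_slabFst :
    MeasurableSet {z : WithLp 2 (E₁ × E₂) | (ofLp z).1 ∈ periodBox Φ₁ 0} :=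
  (measurableSet_periodBox Φ₁ 0).preimage
    (continuous_fst.comp (WithLp.prod_continuous_ofLp 2 E₁ E₂)).measurable

open Classical in
/-- The core of the weighted fibre formula: the formula together with the integrability of the weighted
fibre period (the latter under `ν(e₂, ie₂, …) ≠ 0`). [cite: Federer1969, 3.2.22 (coarea formula);
King1971, §3; Chirka1989, §14.1 Cor., p. 174] -/
private theorem weight_cross_core {q : ℕ} (hq : 0 < q)
    {Z : Set (ComplexTorus (prodPeriodL2 Φ₁ Φ₂))}
    (hZ : HasPureDim 𝓘(ℂ, WithLp 2 (E₁ × E₂)) Z (q + finrank ℂ E₂))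
    (γ : E₁ [⋀^Fin (2 * q)]→L[ℝ] ℂ) (ν : E₂ [⋀^Fin (2 * finrank ℂ E₂)]→L[ℝ] ℂ)
    (h2 : 2 * q + 2 * finrank ℂ E₂ = 2 * (q + finrank ℂ E₂))
    (e₂ : OrthonormalBasis (Fin (finrank ℂ E₂)) ℂ E₂)
    {g : E₂ → ℂ} (hgm : Measurable g) {M : ℝ} (hgM : ∀ t, ‖g t‖ ≤ M) {R : ℝ}
    (hgR : ∀ t, g t ≠ 0 → ‖t‖ ≤ R) :
    (ν (complexFrame ⇑e₂) ≠ 0 → Integrable (fun t ↦ g t *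
        (if h : HasPureDim 𝓘(ℂ, E₁)
            {x : ComplexTorus Φ₁ | (prodHomeomorphL2 Φ₁ Φ₂).symm (x, cover Φ₂ t) ∈ Z} q
          then analyticCyclePeriod Φ₁ h γ else 0)) (μHE[2 * finrank ℂ E₂] : Measure E₂)) ∧
    ∫ z in (analyticChain (prodPeriodL2 Φ₁ Φ₂) hZ).carrier ∩
        {z : WithLp 2 (E₁ × E₂) | (ofLp z).1 ∈ periodBox Φ₁ 0},
        g (ofLp z).2 * ((((γ.compContinuousLinearMap (ContinuousLinearMap.fst ℝ E₁ E₂)).wedge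
            (ν.compContinuousLinearMap (ContinuousLinearMap.snd ℝ E₁ E₂))).domDomCongr
          (finCongr h2)).compContinuousLinearMap
          (WithLp.prodContinuousLinearEquiv 2 ℝ E₁ E₂ : WithLp 2 (E₁ × E₂) →L[ℝ] E₁ × E₂))
          ((analyticChain (prodPeriodL2 Φ₁ Φ₂) hZ).orientationFrame z)
        ∂(μHE[2 * (q + finrank ℂ E₂)] : Measure (WithLp 2 (E₁ × E₂))) =
      ν (complexFrame ⇑e₂) * ∫ t, g t *
        (if h : HasPureDim 𝓘(ℂ, E₁)
            {x : ComplexTorus Φ₁ | (prodHomeomorphL2 Φ₁ Φ₂).symm (x, cover Φ₂ t) ∈ Z} q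
          then analyticCyclePeriod Φ₁ h γ else 0) ∂(μHE[2 * finrank ℂ E₂] : Measure E₂) := by
  classical
  -- ### notation and basic facts
  set T := analyticChain (prodPeriodL2 Φ₁ Φ₂) hZ with hT
  set A : Set (WithLp 2 (E₁ × E₂)) := cover (prodPeriodL2 Φ₁ Φ₂) ⁻¹' Z with hA
  set C : Set (WithLp 2 (E₁ × E₂)) := T.carrier with hC
  set slab : Set (WithLp 2 (E₁ × E₂)) := {z | (ofLp z).1 ∈ periodBox Φ₁ 0} with hslab
  set box : Set (WithLp 2 (E₁ × E₂)) := {z | (ofLp z).1 ∈ periodBox Φ₁ 0 ∧ ‖(ofLp z).2‖ ≤ R} with hbox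
  set Ω : (WithLp 2 (E₁ × E₂)) [⋀^Fin (2 * (q + (finrank ℂ E₂)))]→L[ℝ] ℂ :=
    ((((γ.compContinuousLinearMap (ContinuousLinearMap.fst ℝ E₁ E₂)).wedge
        (ν.compContinuousLinearMap (ContinuousLinearMap.snd ℝ E₁ E₂))).domDomCongr
      (finCongr h2)).compContinuousLinearMap
      (WithLp.prodContinuousLinearEquiv 2 ℝ E₁ E₂ : WithLp 2 (E₁ × E₂) →L[ℝ] E₁ × E₂)) with hΩ
  set F : E₂ → ℂ := fun t ↦
    if h : HasPureDim 𝓘(ℂ, E₁) {x : ComplexTorus Φ₁ | (prodHomeomorphL2 Φ₁ Φ₂).symm (x, cover Φ₂ t) ∈ Z} q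
    then analyticCyclePeriod Φ₁ h γ else 0 with hF
  set G : WithLp 2 (E₁ × E₂) → ℂ := fun z ↦ g (ofLp z).2 with hG
  letI : InnerProductSpace ℝ E₂ := InnerProductSpace.complexToReal
  haveI : FiniteDimensional ℝ E₂ := FiniteDimensional.complexToReal E₂
  letI : InnerProductSpace ℝ (EuclideanSpace ℂ (ULift.{u} (Fin q))) := InnerProductSpace.complexToReal
  haveI : FiniteDimensional ℝ (EuclideanSpace ℂ (ULift.{u} (Fin q))) :=
    FiniteDimensional.complexToReal (EuclideanSpace ℂ (ULift.{u} (Fin q)))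
  have hK₀ : finrank ℂ (EuclideanSpace ℂ (ULift.{u} (Fin q))) = q := by
    rw [finrank_euclideanSpace, Fintype.card_ulift, Fintype.card_fin]
  have hK2 : finrank ℝ (EuclideanSpace ℂ (ULift.{u} (Fin q))) = 2 * q := by rw [finrank_real_of_complex, hK₀]
  have hV22 : finrank ℝ E₂ = 2 * finrank ℂ E₂ := by rw [finrank_real_of_complex]
  haveI : SigmaFinite (μHE[2 * q] : Measure (EuclideanSpace ℂ (ULift.{u} (Fin q)))) := by
    rw [← hK2, InnerProductSpace.euclideanHausdorffMeasure_eq_volume]; infer_instance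
  haveI : (μHE[2 * (finrank ℂ E₂)] : Measure E₂).IsAddHaarMeasure := by
    rw [← hV22, InnerProductSpace.euclideanHausdorffMeasure_eq_volume]; infer_instance
  have hD : 0 < q + (finrank ℂ E₂) := by omega
  have hn : finrank ℂ (WithLp 2 (E₁ × E₂)) = finrank ℂ E₁ + (finrank ℂ E₂) := by
    rw [(WithLp.linearEquiv 2 ℂ (E₁ × E₂)).finrank_eq, Module.finrank_prod]
  obtain ⟨c₀, hc₀, hAc⟩ := hasPureDim_preimage_cover (prodPeriodL2 Φ₁ Φ₂) hZ
  have hn₁ : finrank ℂ E₁ = q + c₀ := by omega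
  have hmemC : ∀ z, z ∈ C ↔ z ∈ A ∧ ∃ c, SCV.IsRegPt A c z := fun z ↦
    mem_carrier_analyticChain_iff_isRegPt (prodPeriodL2 Φ₁ Φ₂) hZ
  have hCA : C ⊆ A := fun z hz ↦ ((hmemC z).1 hz).1
  have hCreg : ∀ z ∈ C, SCV.IsRegPt A c₀ z := fun z hz ↦ by
    have h := isRegPt_of_mem_carrier_analyticChain (prodPeriodL2 Φ₁ Φ₂) hZ hz
    rwa [show finrank ℂ (WithLp 2 (E₁ × E₂)) - (q + (finrank ℂ E₂)) = c₀ by omega] at h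
  have hCeq : C = regularLocus 𝓘(ℂ, WithLp 2 (E₁ × E₂)) A := carrier_analyticChain_eq (prodPeriodL2 Φ₁ Φ₂) hZ
  have hCm : MeasurableSet C := T.measurableSet_carrier
  have hslabm : MeasurableSet slab := measurableSet_slabFst (E₂ := E₂) Φ₁
  have hboxm : MeasurableSet box := measurableSet_slabWindow (E₂ := E₂) Φ₁ R
  have hboxslab : box ⊆ slab := fun z hz ↦ hz.1
  -- the weight: measurable, bounded, vanishing off the window
  have hGm : Measurable G := hgm.comp (measurable_snd.comp (WithLp.prod_continuous_ofLp 2 E₁ E₂).measurable)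
  have hGM : ∀ z, ‖G z‖ ≤ M := fun z ↦ hgM _
  have hM0 : 0 ≤ M := (norm_nonneg _).trans (hgM 0)
  have hG0 : ∀ z ∈ (C ∩ slab) \ (C ∩ box), G z * Ω (T.orientationFrame z) = 0 := by
    rintro z ⟨⟨hzC, hzslab⟩, hzbox⟩
    have hgz : g (ofLp z).2 = 0 := by
      by_contra h
      exact hzbox ⟨hzC, hzslab, hgR _ h⟩
    show g (ofLp z).2 * _ = 0
    rw [hgz, zero_mul]
  -- integrability on the bounded window
  have hint0 : IntegrableOn (fun z ↦ Ω (T.orientationFrame z)) (C ∩ box)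
      (μHE[2 * (q + (finrank ℂ E₂))] : Measure (WithLp 2 (E₁ × E₂))) :=
    integrableOn_apply_orientationFrame_carrier_inter_of_isBounded (prodPeriodL2 Φ₁ Φ₂) hZ Ω
      (isBounded_slabWindow (E₂ := E₂) Φ₁ R) hboxm
  have hint : IntegrableOn (fun z ↦ G z * Ω (T.orientationFrame z)) (C ∩ box)
      (μHE[2 * (q + (finrank ℂ E₂))] : Measure (WithLp 2 (E₁ × E₂))) := by
    refine Integrable.mono' (hint0.norm.const_mul M) (hGm.aestronglyMeasurable.mul hint0.aestronglyMeasurable)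
      (ae_of_all _ fun z ↦ ?_)
    rw [norm_mul]
    exact mul_le_mul_of_nonneg_right (hGM z) (norm_nonneg _)
  -- ### Step 0: reduction of the domain to the bounded window
  rw [setIntegral_eq_of_subset_of_forall_sdiff_eq_zero (hCm.inter hslabm)
    (inter_subset_inter_right C hboxslab) hG0]
  -- ### Step 1: adapted sheets through the non-critical regular points
  have hsheet : ∀ z ∈ C, (∃ (U : Set (WithLp 2 (E₁ × E₂))) (c : ℕ) (g : WithLp 2 (E₁ × E₂) → (Fin c → ℂ)),
      IsOpen U ∧ z ∈ U ∧ DifferentiableOn ℂ g U ∧ A ∩ U = U ∩ g ⁻¹' {0} ∧ Surjective (fderiv ℂ g z) ∧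
      ∀ v : E₂, ∃ u : WithLp 2 (E₁ × E₂), fderiv ℂ g z u = 0 ∧ (ofLp u).2 = v) →
      ∃ (ℓ₁ : E₁ →L[ℂ] EuclideanSpace ℂ (ULift.{u} (Fin q)))
        (ℓ : WithLp 2 (E₁ × E₂) →L[ℂ] WithLp 2 (EuclideanSpace ℂ (ULift.{u} (Fin q)) × E₂))
        (W : Set (WithLp 2 (EuclideanSpace ℂ (ULift.{u} (Fin q)) × E₂)))
        (s : WithLp 2 (EuclideanSpace ℂ (ULift.{u} (Fin q)) × E₂) → WithLp 2 (E₁ × E₂)) (N : Set (WithLp 2 (E₁ × E₂))),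
        (∀ z, ℓ z = toLp 2 (ℓ₁ (ofLp z).1, (ofLp z).2)) ∧ IsOpen W ∧ IsOpen N ∧ DifferentiableOn ℂ s W ∧
        (∀ w ∈ W, ℓ (s w) = w) ∧ s '' W = A ∩ N ∧ A ∩ N ⊆ C ∧ z ∈ N := by
    intro z hzC hzNC
    obtain ⟨U, c, g, hU, hzU, hg, hAU, hsurj, hnc⟩ := hzNC
    have hzA := hCA hzC
    have hcc : c = c₀ := SCV.IsRegPt.codim_unique hzA ⟨U, hU, hzU, g, hg, hAU, hsurj⟩ (hCreg z hzC)
    subst hcc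
    obtain ⟨ℓ₁, ℓ, W, s, N, hℓ, hW, hN, hzN, hNU, hs, hℓs, himg, hsurjN⟩ :=
      exists_adapted_section_of_finrank_eq hU hzU hzA hg hAU hsurj hnc hn₁ hK₀
    refine ⟨ℓ₁, ℓ, W, s, N, hℓ, hW, hN, hs, hℓs, himg, ?_, hzN⟩
    rintro z' ⟨hz'A, hz'N⟩
    exact (hmemC z').2 ⟨hz'A, c, U, hU, hNU hz'N, g, hg, hAU, hsurjN z' hz'N⟩
  -- ### Step 2: a countable family of sheets covering the non-critical part of the carrier
  set C₀ : Set (WithLp 2 (E₁ × E₂)) := {z ∈ C | ∃ (U : Set (WithLp 2 (E₁ × E₂))) (c : ℕ)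
      (g : WithLp 2 (E₁ × E₂) → (Fin c → ℂ)),
      IsOpen U ∧ z ∈ U ∧ DifferentiableOn ℂ g U ∧ A ∩ U = U ∩ g ⁻¹' {0} ∧ Surjective (fderiv ℂ g z) ∧
      ∀ v : E₂, ∃ u : WithLp 2 (E₁ × E₂), fderiv ℂ g z u = 0 ∧ (ofLp u).2 = v} with hC₀
  -- a "junk" adapted linear map for empty sheets
  set ℓ0 : WithLp 2 (E₁ × E₂) →L[ℂ] WithLp 2 (EuclideanSpace ℂ (ULift.{u} (Fin q)) × E₂) :=
    (((WithLp.prodContinuousLinearEquiv 2 ℂ (EuclideanSpace ℂ (ULift.{u} (Fin q))) E₂).symm :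
        EuclideanSpace ℂ (ULift.{u} (Fin q)) × E₂ →L[ℂ] WithLp 2 (EuclideanSpace ℂ (ULift.{u} (Fin q)) × E₂)).comp
      (((0 : E₁ →L[ℂ] EuclideanSpace ℂ (ULift.{u} (Fin q))).prodMap (ContinuousLinearMap.id ℂ E₂)).comp
        (WithLp.prodContinuousLinearEquiv 2 ℂ E₁ E₂ : WithLp 2 (E₁ × E₂) →L[ℂ] E₁ × E₂))) with hℓ0def
  have hℓ0 : ∀ z, ℓ0 z = toLp 2 ((0 : E₁ →L[ℂ] EuclideanSpace ℂ (ULift.{u} (Fin q))) (ofLp z).1, (ofLp z).2) :=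
    fun z ↦ rfl
  obtain ⟨𝔩₁, 𝔩, 𝔚, 𝔰, 𝔑, hSP, hcov⟩ : ∃ (𝔩₁ : ℕ → (E₁ →L[ℂ] EuclideanSpace ℂ (ULift.{u} (Fin q))))
      (𝔩 : ℕ → (WithLp 2 (E₁ × E₂) →L[ℂ] WithLp 2 (EuclideanSpace ℂ (ULift.{u} (Fin q)) × E₂)))
      (𝔚 : ℕ → Set (WithLp 2 (EuclideanSpace ℂ (ULift.{u} (Fin q)) × E₂)))
      (𝔰 : ℕ → WithLp 2 (EuclideanSpace ℂ (ULift.{u} (Fin q)) × E₂) → WithLp 2 (E₁ × E₂))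
      (𝔑 : ℕ → Set (WithLp 2 (E₁ × E₂))),
      (∀ n, (∀ z, 𝔩 n z = toLp 2 (𝔩₁ n (ofLp z).1, (ofLp z).2)) ∧ IsOpen (𝔚 n) ∧ IsOpen (𝔑 n) ∧
        DifferentiableOn ℂ (𝔰 n) (𝔚 n) ∧ (∀ w ∈ 𝔚 n, 𝔩 n (𝔰 n w) = w) ∧ 𝔰 n '' 𝔚 n = A ∩ 𝔑 n ∧
        A ∩ 𝔑 n ⊆ C) ∧ C₀ ⊆ ⋃ n, 𝔑 n := by
    choose! f₁ f f𝔚 f𝔰 f𝔑 hf using hsheet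
    have hLind : ∃ 𝒯 ⊆ C₀, 𝒯.Countable ∧ C₀ ⊆ ⋃ z ∈ 𝒯, f𝔑 z := by
      apply TopologicalSpace.countable_cover_nhdsWithin
      intro z hz
      have h := hf z hz.1 hz.2
      exact mem_nhdsWithin_of_mem_nhds (h.2.2.1.mem_nhds h.2.2.2.2.2.2.2)
    obtain ⟨𝒯, h𝒯C₀, h𝒯c, h𝒯cov⟩ := hLind
    rcases 𝒯.eq_empty_or_nonempty with h𝒯 | h𝒯
    · refine ⟨fun _ ↦ 0, fun _ ↦ ℓ0, fun _ ↦ ∅, fun _ _ ↦ 0, fun _ ↦ ∅, fun n ↦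
        ⟨hℓ0, isOpen_empty, isOpen_empty, differentiableOn_empty, fun w hw ↦ hw.elim, by simp,
          by simp⟩, ?_⟩
      rw [h𝒯] at h𝒯cov
      intro z hz
      simpa using h𝒯cov hz
    · obtain ⟨e, he⟩ := h𝒯c.exists_eq_range h𝒯
      have he' : ∀ n, e n ∈ C₀ := fun n ↦ h𝒯C₀ (he ▸ mem_range_self n)
      refine ⟨fun n ↦ f₁ (e n), fun n ↦ f (e n), fun n ↦ f𝔚 (e n), fun n ↦ f𝔰 (e n),
        fun n ↦ f𝔑 (e n), fun n ↦ ?_, ?_⟩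
      · have h := hf (e n) (he' n).1 (he' n).2
        exact ⟨h.1, h.2.1, h.2.2.1, h.2.2.2.1, h.2.2.2.2.1, h.2.2.2.2.2.1, h.2.2.2.2.2.2.1⟩
      · intro z hz
        obtain ⟨z', hz'𝒯, hzz'⟩ := mem_iUnion₂.1 (h𝒯cov hz)
        obtain ⟨n, rfl⟩ : z' ∈ range e := he ▸ hz'𝒯
        exact mem_iUnion.2 ⟨n, hzz'⟩
  -- derived sheet facts
  have hℓ₂ : ∀ n z, (ofLp (𝔩 n z)).2 = (ofLp z).2 := fun n z ↦ by rw [(hSP n).1 z]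
  have hsW : ∀ n, 𝔰 n '' 𝔚 n ⊆ C := fun n ↦ (hSP n).2.2.2.2.2.1 ▸ (hSP n).2.2.2.2.2.2
  have hsWN : ∀ n, 𝔰 n '' 𝔚 n = C ∩ 𝔑 n := fun n ↦ by
    apply Subset.antisymm
    · exact subset_inter (hsW n) ((hSP n).2.2.2.2.2.1 ▸ inter_subset_right)
    · rw [(hSP n).2.2.2.2.2.1]
      exact fun z hz ↦ ⟨hCA hz.1, hz.2⟩
  have hopen : ∀ n, ∀ w ∈ 𝔚 n, ∃ N ∈ 𝓝 (𝔰 n w), C ∩ N ⊆ 𝔰 n '' 𝔚 n := fun n w hw ↦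
    ⟨𝔑 n, (hSP n).2.2.1.mem_nhds ((hsWN n ▸ mem_image_of_mem _ hw : 𝔰 n w ∈ C ∩ 𝔑 n).2),
      (hsWN n).symm ▸ Subset.rfl⟩
  have hs2 : ∀ n, ∀ w ∈ 𝔚 n, (ofLp (𝔰 n w)).2 = (ofLp w).2 := fun n w hw ↦ by
    rw [← hℓ₂ n (𝔰 n w), (hSP n).2.2.2.2.1 w hw]
  -- ### Step 3: disjoint measurable pieces, and the critical remainder
  set B : ℕ → Set (WithLp 2 (E₁ × E₂)) := disjointed (fun n ↦ C ∩ box ∩ 𝔑 n) with hB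
  have hBm : ∀ n, MeasurableSet (B n) := fun n ↦
    MeasurableSet.disjointed (fun n ↦ (hCm.inter hboxm).inter (hSP n).2.2.1.measurableSet) n
  have hBd : Pairwise (Disjoint on B) := disjoint_disjointed _
  have hBsub : ∀ n, B n ⊆ C ∩ box ∩ 𝔑 n := fun n ↦ disjointed_le (fun n ↦ C ∩ box ∩ 𝔑 n) n
  have hBU : (⋃ n, B n) = C ∩ box ∩ ⋃ n, 𝔑 n := by
    rw [hB, iUnion_disjointed, inter_iUnion]
  have hzero : ∀ z ∈ (C ∩ box) \ ⋃ n, B n, G z * Ω (T.orientationFrame z) = 0 := by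
    rintro z ⟨⟨hzC, hzbox⟩, hzU⟩
    obtain ⟨U, hU, hzU', g', hg', hAU, hsurj⟩ := hCreg z hzC
    have hcrit : ¬ ∀ v : E₂, ∃ u : WithLp 2 (E₁ × E₂), fderiv ℂ g' z u = 0 ∧ (ofLp u).2 = v := by
      intro h
      have hz0 : z ∈ C₀ := ⟨hzC, U, c₀, g', hU, hzU', hg', hAU, hsurj, h⟩
      exact hzU (hBU ▸ ⟨⟨hzC, hzbox⟩, hcov hz0⟩)
    have hgz : ∀ z' ∈ A ∩ U, g' z' = 0 := fun z' hz' ↦ (hAU ▸ hz' : z' ∈ U ∩ g' ⁻¹' {0}).2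
    have h0 : Ω (T.orientationFrame z) = 0 := by
      refine T.cross_apply_orientationFrame_eq_zero_of_critical h2 rfl hzC (hU.mem_nhds hzU')
        (hg'.differentiableAt (hU.mem_nhds hzU')) (fun z' hz' ↦ ?_) hsurj (by omega) hcrit γ ν
      rw [hgz z' ⟨hCA hz'.1, hz'.2⟩, hgz z ⟨hCA hzC, hzU'⟩]
    rw [h0, mul_zero]
  have hLHS : ∫ z in C ∩ box, G z * Ω (T.orientationFrame z) ∂(μHE[2 * (q + (finrank ℂ E₂))] :
      Measure (WithLp 2 (E₁ × E₂))) =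
      ∑' n, ∫ z in B n, G z * Ω (T.orientationFrame z) ∂(μHE[2 * (q + (finrank ℂ E₂))] :
        Measure (WithLp 2 (E₁ × E₂))) := by
    rw [setIntegral_eq_of_subset_of_forall_sdiff_eq_zero (hCm.inter hboxm) (hBU ▸ inter_subset_left) hzero,
      integral_iUnion hBm hBd (hint.mono_set (hBU ▸ inter_subset_left))]
  -- ### Step 4: the local coarea formula on each piece
  -- the parameter sets of the pieces
  set 𝔖 : ℕ → Set (WithLp 2 (EuclideanSpace ℂ (ULift.{u} (Fin q)) × E₂)) := fun n ↦ {w | w ∈ 𝔚 n ∧ 𝔰 n w ∈ B n}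
    with h𝔖
  have h𝔖W : ∀ n, 𝔖 n ⊆ 𝔚 n := fun n w hw ↦ hw.1
  have himg : ∀ n, 𝔰 n '' 𝔖 n = B n := fun n ↦ by
    apply Subset.antisymm
    · rintro _ ⟨w, hw, rfl⟩; exact hw.2
    · intro z hz
      obtain ⟨w, hw, rfl⟩ : z ∈ 𝔰 n '' 𝔚 n := hsWN n ▸ ⟨(hBsub n hz).1.1, (hBsub n hz).2⟩
      exact ⟨w, ⟨hw, hz⟩, rfl⟩
  have h𝔖m : ∀ n, MeasurableSet (𝔖 n) := fun n ↦ by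
    have hmeas : Measurable ((𝔚 n).piecewise (𝔰 n) (fun _ ↦ (0 : WithLp 2 (E₁ × E₂)))) :=
      ContinuousOn.measurable_piecewise (hSP n).2.2.2.1.continuousOn continuousOn_const
        (hSP n).2.1.measurableSet
    have : 𝔖 n = 𝔚 n ∩ (𝔚 n).piecewise (𝔰 n) (fun _ ↦ (0 : WithLp 2 (E₁ × E₂))) ⁻¹' B n := by
      ext w
      simp only [h𝔖, mem_setOf_eq, mem_inter_iff, mem_preimage]
      constructor
      · rintro ⟨hw, hB⟩; exact ⟨hw, by rwa [piecewise_eq_of_mem _ _ _ hw]⟩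
      · rintro ⟨hw, hB⟩; exact ⟨hw, by rwa [piecewise_eq_of_mem _ _ _ hw] at hB⟩
    rw [this]
    exact (hSP n).2.1.measurableSet.inter (hmeas (hBm n))
  set e' : OrthonormalBasis (Fin q) ℂ (EuclideanSpace ℂ (ULift.{u} (Fin q))) :=
    (EuclideanSpace.basisFun (ULift.{u} (Fin q)) ℂ).reindex Equiv.ulift with he'
  -- the weighted fibre integrals of the pieces
  set Fn : ℕ → E₂ → ℂ := fun n t ↦ ∫ x in {x : EuclideanSpace ℂ (ULift.{u} (Fin q)) | toLp 2 (x, t) ∈ 𝔖 n},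
      G (𝔰 n (toLp 2 (x, t))) *
      γ (fun i ↦ (ofLp (fderiv ℂ (𝔰 n) (toLp 2 (x, t)) (toLp 2 (complexFrame ⇑e' i, (0 : E₂))))).1)
      ∂(μHE[2 * q] : Measure (EuclideanSpace ℂ (ULift.{u} (Fin q)))) with hFn
  have hintB : ∀ n, IntegrableOn (fun z ↦ G z * Ω (T.orientationFrame z)) (𝔰 n '' 𝔖 n)
      (μHE[2 * (q + (finrank ℂ E₂))] : Measure (WithLp 2 (E₁ × E₂))) := fun n ↦ by
    rw [himg n]
    exact hint.mono_set ((hBsub n).trans inter_subset_left)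
  have hpiece : ∀ n, ∫ z in B n, G z * Ω (T.orientationFrame z)
      ∂(μHE[2 * (q + (finrank ℂ E₂))] : Measure (WithLp 2 (E₁ × E₂))) =
      ν (complexFrame ⇑e₂) * ∫ t, Fn n t ∂(μHE[2 * (finrank ℂ E₂)] : Measure E₂) := fun n ↦ by
    have h := HolomorphicChain.integral_image_section_cross_eq hD T rfl h2 hK₀ rfl (𝔩 n) (hℓ₂ n)
      (hSP n).2.1 (hSP n).2.2.2.1 (hSP n).2.2.2.2.1 (hsW n) (hopen n) γ ν G e' e₂
      (h𝔖m n) (h𝔖W n) (hintB n)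
    rw [himg n] at h
    rw [h]
  -- the case `ν(e₂, ie₂, …) = 0` is degenerate: both sides vanish, and the integrability is not claimed
  by_cases hν : ν (complexFrame ⇑e₂) = 0
  · refine ⟨fun h ↦ (h hν).elim, ?_⟩
    rw [hLHS]
    simp_rw [hpiece]
    rw [hν]
    simp
  -- ### Step 5: interchange of sum and fibre integral
  have h𝔖' : ∀ n, MeasurableSet ((toLp 2 : EuclideanSpace ℂ (ULift.{u} (Fin q)) × E₂ →
      WithLp 2 (EuclideanSpace ℂ (ULift.{u} (Fin q)) × E₂)) ⁻¹' 𝔖 n) := fun n ↦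
    (h𝔖m n).preimage (WithLp.measurable_toLp 2 _)
  have h𝔖t : ∀ n t, MeasurableSet {x : EuclideanSpace ℂ (ULift.{u} (Fin q)) | toLp 2 (x, t) ∈ 𝔖 n} := fun n t ↦
    (h𝔖' n).preimage measurable_prodMk_right
  have hF_int : ∀ n, Integrable (Fn n) (μHE[2 * (finrank ℂ E₂)] : Measure E₂) := fun n ↦ by
    have hI := HolomorphicChain.integrableOn_preimage_toLp_cross_integrand hD T rfl h2 hK₀ rfl (𝔩 n)
      (hℓ₂ n) (hSP n).2.1 (hSP n).2.2.2.1 (hSP n).2.2.2.2.1 (hsW n) (hopen n) γ ν G e' e₂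
      hν (h𝔖m n) (h𝔖W n) (hintB n)
    have hI' := ((integrable_indicator_iff (h𝔖' n)).2 hI).integral_prod_right
    refine hI'.congr (ae_of_all _ fun t ↦ ?_)
    simp only [hFn]
    rw [← integral_indicator (h𝔖t n t)]
    rfl
  have hF_meas : ∀ n, AEStronglyMeasurable (Fn n) (μHE[2 * (finrank ℂ E₂)] : Measure E₂) := fun n ↦
    (hF_int n).aestronglyMeasurable
  have hF_sum : ∑' n, ∫⁻ t, ‖Fn n t‖ₑ ∂(μHE[2 * (finrank ℂ E₂)] : Measure E₂) ≠ ∞ := by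
    have hνe : ‖ν (complexFrame ⇑e₂)‖ₑ ≠ 0 := by simpa using hν
    have hνt : ‖ν (complexFrame ⇑e₂)‖ₑ ≠ ⊤ := enorm_ne_top
    have hGme : Measurable fun z : WithLp 2 (E₁ × E₂) ↦ ‖G z‖ₑ := hGm.enorm
    have hlin : ∀ n, ∫⁻ t, ∫⁻ x in {x : EuclideanSpace ℂ (ULift.{u} (Fin q)) | toLp 2 (x, t) ∈ 𝔖 n},
        ‖G (𝔰 n (toLp 2 (x, t)))‖ₑ * ‖γ (fun i ↦ (ofLp (fderiv ℂ (𝔰 n) (toLp 2 (x, t))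
          (toLp 2 (complexFrame ⇑e' i, (0 : E₂))))).1)‖ₑ
          ∂(μHE[2 * q] : Measure (EuclideanSpace ℂ (ULift.{u} (Fin q)))) ∂(μHE[2 * (finrank ℂ E₂)] : Measure E₂) =
        ‖ν (complexFrame ⇑e₂)‖ₑ⁻¹ *
          ∫⁻ z in B n, ‖G z‖ₑ * ‖Ω (T.orientationFrame z)‖ₑ
            ∂(μHE[2 * (q + (finrank ℂ E₂))] : Measure (WithLp 2 (E₁ × E₂))) := by
      intro n
      have h := HolomorphicChain.lintegral_image_section_cross_eq_enorm hD T rfl h2 hK₀ rfl (𝔩 n) (hℓ₂ n)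
        (hSP n).2.1 (hSP n).2.2.2.1 (hSP n).2.2.2.2.1 (hsW n) (hopen n) γ ν (G := fun z ↦ ‖G z‖ₑ)
        hGme e' e₂ (h𝔖m n) (h𝔖W n)
      rw [himg n] at h
      rw [h, ← mul_assoc, ENNReal.inv_mul_cancel hνe hνt, one_mul]
    have hle : ∀ n, ∫⁻ t, ‖Fn n t‖ₑ ∂(μHE[2 * (finrank ℂ E₂)] : Measure E₂) ≤ ‖ν (complexFrame ⇑e₂)‖ₑ⁻¹ *
        ∫⁻ z in B n, ‖G z‖ₑ * ‖Ω (T.orientationFrame z)‖ₑ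
          ∂(μHE[2 * (q + (finrank ℂ E₂))] : Measure (WithLp 2 (E₁ × E₂))) :=
      fun n ↦ by
      rw [← hlin n]
      refine lintegral_mono fun t ↦ ?_
      refine (enorm_integral_le_lintegral_enorm _).trans (lintegral_mono fun x ↦ ?_)
      rw [enorm_mul]
    refine ne_top_of_le_ne_top ?_ (ENNReal.tsum_le_tsum hle)
    rw [ENNReal.tsum_mul_left, ← lintegral_iUnion hBm hBd]
    refine ENNReal.mul_ne_top (ENNReal.inv_ne_top.2 hνe) ?_
    have h1 : ∫⁻ z in ⋃ n, B n, ‖G z‖ₑ * ‖Ω (T.orientationFrame z)‖ₑ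
        ∂(μHE[2 * (q + (finrank ℂ E₂))] : Measure (WithLp 2 (E₁ × E₂))) =
        ∫⁻ z in ⋃ n, B n, ‖G z * Ω (T.orientationFrame z)‖ₑ
        ∂(μHE[2 * (q + (finrank ℂ E₂))] : Measure (WithLp 2 (E₁ × E₂))) :=
      lintegral_congr fun z ↦ by rw [enorm_mul]
    rw [h1]
    exact (hint.mono_set (hBU ▸ inter_subset_left)).2.ne
  have hsum_int : Integrable (fun t ↦ ∑' n, Fn n t) (μHE[2 * (finrank ℂ E₂)] : Measure E₂) := by
    have hF_ae : ∀ n, AEMeasurable (fun t ↦ ‖Fn n t‖ₑ) (μHE[2 * (finrank ℂ E₂)] : Measure E₂) := fun n ↦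
      (hF_meas n).enorm
    have hlt : ∫⁻ t, ∑' n, ‖Fn n t‖ₑ ∂(μHE[2 * (finrank ℂ E₂)] : Measure E₂) < ∞ := by
      rw [lintegral_tsum hF_ae]
      exact lt_top_iff_ne_top.2 hF_sum
    have hae : ∀ᵐ t ∂(μHE[2 * (finrank ℂ E₂)] : Measure E₂), Summable (fun n ↦ Fn n t) := by
      filter_upwards [ae_lt_top' (AEMeasurable.tsum hF_ae) hlt.ne] with t ht
      have h1 : (∑' n, ((‖Fn n t‖₊ : ℝ≥0) : ℝ≥0∞)) ≠ ∞ := by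
        simpa only [enorm] using ht.ne
      exact (ENNReal.tsum_coe_ne_top_iff_summable.1 h1).of_nnnorm
    have hmeas : AEStronglyMeasurable (fun t ↦ ∑' n, Fn n t) (μHE[2 * (finrank ℂ E₂)] : Measure E₂) := by
      refine aestronglyMeasurable_of_tendsto_ae atTop
        (fun N ↦ Finset.aestronglyMeasurable_sum (Finset.range N) fun n _ ↦ hF_meas n) ?_
      filter_upwards [hae] with t ht
      simp only [Finset.sum_apply]
      exact ht.hasSum.tendsto_sum_nat
    refine ⟨hmeas, ?_⟩
    exact lt_of_le_of_lt (lintegral_mono fun t ↦ enorm_tsum_le_tsum_enorm) hlt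
  -- ### Step 6: identification of the fibre integrals, for a.e. `t`
  have hfib : ∀ᵐ t ∂(μHE[2 * (finrank ℂ E₂)] : Measure E₂), ∑' n, Fn n t = g t * F t := by
    filter_upwards [ae_hasPureDim_fibreSlice Φ₁ Φ₂ (μHE[2 * (finrank ℂ E₂)] : Measure E₂) hZ] with t ht
    obtain ⟨ht1, ht2, ht3⟩ := ht
    -- the parameter points of the pieces over `t`
    have hSt : ∀ n (x : EuclideanSpace ℂ (ULift.{u} (Fin q))), toLp 2 (x, t) ∈ 𝔖 n →
        𝔰 n (toLp 2 (x, t)) ∈ C ∩ box ∧ (ofLp (𝔰 n (toLp 2 (x, t)))).2 = t := fun n x hx ↦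
      ⟨(hBsub n hx.2).1, hs2 n _ hx.1⟩
    have hsxt : ∀ n (x : EuclideanSpace ℂ (ULift.{u} (Fin q))), toLp 2 (x, t) ∈ 𝔚 n →
        𝔰 n (toLp 2 (x, t)) = toLp 2 ((ofLp (𝔰 n (toLp 2 (x, t)))).1, t) := fun n x hx ↦ by
      have h' : ofLp (𝔰 n (toLp 2 (x, t))) = ((ofLp (𝔰 n (toLp 2 (x, t)))).1, t) :=
        Prod.ext rfl (hs2 n _ hx)
      calc 𝔰 n (toLp 2 (x, t)) = toLp 2 (ofLp (𝔰 n (toLp 2 (x, t)))) := rfl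
        _ = toLp 2 ((ofLp (𝔰 n (toLp 2 (x, t)))).1, t) := by rw [h']
    -- the weight is constant along the fibre: `G(𝔰(x,t)) = g t`
    have hGt : ∀ n (x : EuclideanSpace ℂ (ULift.{u} (Fin q))), toLp 2 (x, t) ∈ 𝔖 n →
        G (𝔰 n (toLp 2 (x, t))) = g t := fun n x hx ↦ by
      simp only [hG]
      rw [(hSt n x hx).2]
    have hFn' : ∀ n, Fn n t = g t * ∫ x in {x : EuclideanSpace ℂ (ULift.{u} (Fin q)) | toLp 2 (x, t) ∈ 𝔖 n},
        γ (fun i ↦ (ofLp (fderiv ℂ (𝔰 n) (toLp 2 (x, t)) (toLp 2 (complexFrame ⇑e' i, (0 : E₂))))).1)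
        ∂(μHE[2 * q] : Measure (EuclideanSpace ℂ (ULift.{u} (Fin q)))) := fun n ↦ by
      simp only [hFn]
      rw [← integral_const_mul]
      exact setIntegral_congr_fun (h𝔖t n t) fun x hx ↦ by rw [hGt n x hx]
    -- if all the pieces are empty over `t`, the sum vanishes
    have hempty : (∀ n, {x : EuclideanSpace ℂ (ULift.{u} (Fin q)) | toLp 2 (x, t) ∈ 𝔖 n} = ∅) →
        ∑' n, Fn n t = 0 := fun h ↦ by
      have h0 : ∀ n, Fn n t = 0 := fun n ↦ by
        simp only [hFn, h n, Measure.restrict_empty, integral_zero_measure]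
      simp [h0]
    -- if the weight vanishes at `t`, both sides vanish
    by_cases hgt : g t = 0
    · rw [hgt, zero_mul]
      have h0 : ∀ n, Fn n t = 0 := fun n ↦ by rw [hFn' n, hgt, zero_mul]
      simp [h0]
    have htR : ‖t‖ ≤ R := hgR t hgt
    rcases ht3 with hZt0 | hZt
    · -- empty slice: no piece meets the fibre
      have hF0 : F t = 0 := by
        simp only [hF]
        rw [dif_neg]
        intro h
        exact h.nonempty.ne_empty hZt0
      rw [hF0, mul_zero]
      apply hempty
      intro n
      apply eq_empty_of_forall_notMem
      intro x hx
      have h := hSt n x hx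
      have hxA : (ofLp (𝔰 n (toLp 2 (x, t)))).1 ∈ {y : E₁ | toLp 2 (y, t) ∈ A} := by
        show toLp 2 ((ofLp (𝔰 n (toLp 2 (x, t)))).1, t) ∈ A
        rw [← hsxt n x hx.1]
        exact hCA h.1.1
      rw [setOf_toLp_mem_preimage_cover Φ₁ Φ₂ Z t, hZt0] at hxA
      exact hxA
    -- the generic case: the slice has pure dimension `q`
    have hFt : F t = analyticCyclePeriod Φ₁ hZt γ := by
      simp only [hF]
      rw [dif_pos hZt]
    rw [hFt]
    set Tt := analyticChain Φ₁ hZt with hTt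
    have hAt : {x : E₁ | toLp 2 (x, t) ∈ A} =
        cover Φ₁ ⁻¹' {x | (prodHomeomorphL2 Φ₁ Φ₂).symm (x, cover Φ₂ t) ∈ Z} :=
      setOf_toLp_mem_preimage_cover Φ₁ Φ₂ Z t
    have hmemCt : ∀ x, x ∈ Tt.carrier ↔
        toLp 2 (x, t) ∈ A ∧ ∃ c, SCV.IsRegPt {y : E₁ | toLp 2 (y, t) ∈ A} c x := by
      intro x
      rw [mem_carrier_analyticChain_iff_isRegPt Φ₁ hZt, ← hAt]
      rfl
    -- over `t`, every regular point of `π⁻¹Z` is non-critical, hence slices to a regular point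
    have hNC : ∀ x : E₁, toLp 2 (x, t) ∈ C → ∃ (U : Set (WithLp 2 (E₁ × E₂))) (c : ℕ)
        (g : WithLp 2 (E₁ × E₂) → (Fin c → ℂ)),
        IsOpen U ∧ toLp 2 (x, t) ∈ U ∧ DifferentiableOn ℂ g U ∧ A ∩ U = U ∩ g ⁻¹' {0} ∧
        Surjective (fderiv ℂ g (toLp 2 (x, t))) ∧
        ∀ v : E₂, ∃ u : WithLp 2 (E₁ × E₂), fderiv ℂ g (toLp 2 (x, t)) u = 0 ∧ (ofLp u).2 = v := by
      intro x hxC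
      by_contra hn
      exact ht1 ⟨toLp 2 (x, t), ⟨hCA hxC, ⟨c₀, hCreg _ hxC⟩, hn⟩, rfl⟩
    have hsliceC : ∀ x : E₁, toLp 2 (x, t) ∈ C → x ∈ Tt.carrier := by
      intro x hxC
      obtain ⟨U, c, g', hU, hzU, hg', hAU, hsurj, hnc⟩ := hNC x hxC
      obtain ⟨U', hU', hzU', g'', hg'', hAU', hsurj'⟩ := hCreg _ hxC
      exact (hmemCt x).2 ⟨hCA hxC, c₀, isRegPt_slice_of_nonCritical (hCA hxC) hU hzU hg' hAU hsurj hnc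
        hU' hzU' hg'' hAU' hsurj'⟩
    -- the slices of the pieces, their union, and the carrier of the slice chain
    have hBt_m : ∀ n, MeasurableSet {x : E₁ | toLp 2 (x, t) ∈ B n} := fun n ↦
      (hBm n).preimage ((WithLp.measurable_toLp 2 _).comp measurable_prodMk_right)
    have hBt_d : Pairwise (Disjoint on fun n ↦ {x : E₁ | toLp 2 (x, t) ∈ B n}) := fun i j hij ↦
      (hBd hij).preimage _
    set Ut : Set E₁ := ⋃ n, {x : E₁ | toLp 2 (x, t) ∈ B n} with hUt
    set Vt : Set E₁ := Tt.carrier ∩ periodBox Φ₁ 0 with hVt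
    have hUV : Ut ⊆ Vt := by
      intro x hx
      obtain ⟨n, hn⟩ := mem_iUnion.1 hx
      have h := hBsub n hn
      exact ⟨hsliceC x h.1.1, h.1.2.1⟩
    have hVU : Vt \ Ut ⊆ {x : E₁ | toLp 2 (x, t) ∈ singularLocus 𝓘(ℂ, WithLp 2 (E₁ × E₂)) A} := by
      rintro x ⟨⟨hxCt, hxbox⟩, hxU⟩
      have hxA : toLp 2 (x, t) ∈ A := ((hmemCt x).1 hxCt).1
      refine ⟨hxA, fun hreg ↦ hxU ?_⟩
      have hzC : toLp 2 (x, t) ∈ C := by rw [hCeq]; exact hreg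
      have hz0 : toLp 2 (x, t) ∈ C₀ := ⟨hzC, hNC x hzC⟩
      have hzbox : toLp 2 (x, t) ∈ box := ⟨hxbox, htR⟩
      have hzB : toLp 2 (x, t) ∈ ⋃ n, B n := hBU ▸ ⟨⟨hzC, hzbox⟩, hcov hz0⟩
      obtain ⟨n, hn⟩ := mem_iUnion.1 hzB
      exact mem_iUnion.2 ⟨n, hn⟩
    have ht2' : μH[((2 * q : ℕ) : ℝ)]
        {x : E₁ | toLp 2 (x, t) ∈ singularLocus 𝓘(ℂ, WithLp 2 (E₁ × E₂)) A} = 0 := ht2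
    have hnull : (μHE[2 * q] : Measure E₁) (Vt \ Ut) = 0 :=
      measure_mono_null hVU (by
        rw [Measure.euclideanHausdorffMeasure_def, Measure.smul_apply, ht2', smul_zero])
    have hUVae : Ut =ᵐ[(μHE[2 * q] : Measure E₁)] Vt := by
      refine ae_eq_set.2 ⟨?_, hnull⟩
      rw [sdiff_eq_empty.2 hUV, measure_empty]
    have hintt : IntegrableOn (fun x ↦ γ (Tt.orientationFrame x)) Vt (μHE[2 * q] : Measure E₁) :=
      integrableOn_apply_orientationFrame_carrier_inter_periodBox Φ₁ hZt γ
    -- each (unweighted) fibre integral is the integral of `γ(ξ_{[Z_t]})` over the slice of the piece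
    have hFn'' : ∀ n, ∫ x in {x : EuclideanSpace ℂ (ULift.{u} (Fin q)) | toLp 2 (x, t) ∈ 𝔖 n},
        γ (fun i ↦ (ofLp (fderiv ℂ (𝔰 n) (toLp 2 (x, t)) (toLp 2 (complexFrame ⇑e' i, (0 : E₂))))).1)
        ∂(μHE[2 * q] : Measure (EuclideanSpace ℂ (ULift.{u} (Fin q)))) =
        ∫ x in {x : E₁ | toLp 2 (x, t) ∈ B n}, γ (Tt.orientationFrame x) ∂(μHE[2 * q] : Measure E₁) := by
      intro n
      have hWt : IsOpen {x : EuclideanSpace ℂ (ULift.{u} (Fin q)) | toLp 2 (x, t) ∈ 𝔚 n} :=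
        (hSP n).2.1.preimage ((WithLp.prod_continuous_toLp 2 (EuclideanSpace ℂ (ULift.{u} (Fin q))) E₂).comp
          (continuous_id.prodMk continuous_const))
      obtain ⟨hst, hDst⟩ := HolomorphicChain.differentiableOn_slice_section (hSP n).2.1 (hSP n).2.2.2.1 t
      have hℓst : ∀ x ∈ {x : EuclideanSpace ℂ (ULift.{u} (Fin q)) | toLp 2 (x, t) ∈ 𝔚 n},
          𝔩₁ n ((ofLp (𝔰 n (toLp 2 (x, t)))).1) = x := fun x hx ↦ by
        have h := (hSP n).2.2.2.2.1 _ hx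
        rw [(hSP n).1] at h
        have h1 := congrArg (fun w ↦ (ofLp w).1) h
        simpa using h1
      have hstW : (fun x' : EuclideanSpace ℂ (ULift.{u} (Fin q)) ↦ (ofLp (𝔰 n (toLp 2 (x', t)))).1) ''
          {x | toLp 2 (x, t) ∈ 𝔚 n} ⊆ Tt.carrier := by
        rintro _ ⟨x, hx, rfl⟩
        apply hsliceC
        rw [← hsxt n x hx]
        exact hsW n (mem_image_of_mem _ hx)
      have hopent : ∀ x ∈ {x : EuclideanSpace ℂ (ULift.{u} (Fin q)) | toLp 2 (x, t) ∈ 𝔚 n},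
          ∃ N ∈ 𝓝 ((ofLp (𝔰 n (toLp 2 (x, t)))).1), Tt.carrier ∩ N ⊆
            (fun x' : EuclideanSpace ℂ (ULift.{u} (Fin q)) ↦ (ofLp (𝔰 n (toLp 2 (x', t)))).1) ''
              {x | toLp 2 (x, t) ∈ 𝔚 n} := by
        intro x hx
        refine ⟨{y : E₁ | toLp 2 (y, t) ∈ 𝔑 n}, ((hSP n).2.2.1.preimage
          ((WithLp.prod_continuous_toLp 2 E₁ E₂).comp (continuous_id.prodMk continuous_const))).mem_nhds ?_,
          ?_⟩
        · show toLp 2 ((ofLp (𝔰 n (toLp 2 (x, t)))).1, t) ∈ 𝔑 n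
          rw [← hsxt n x hx]
          exact ((hsWN n).le (mem_image_of_mem _ hx)).2
        · rintro y ⟨hyC, hyN⟩
          have hyA : toLp 2 (y, t) ∈ A := ((hmemCt y).1 hyC).1
          have hy : toLp 2 (y, t) ∈ 𝔰 n '' 𝔚 n := by
            rw [(hSP n).2.2.2.2.2.1]; exact ⟨hyA, hyN⟩
          have heq := HolomorphicChain.slice_image_section_eq (𝔩 n) (hℓ₂ n) (hSP n).2.2.2.2.1
            (S := 𝔚 n) Subset.rfl t
          show y ∈ (fun x' : EuclideanSpace ℂ (ULift.{u} (Fin q)) ↦ (ofLp (𝔰 n (toLp 2 (x', t)))).1) ''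
              {x | toLp 2 (x, t) ∈ 𝔚 n}
          rw [← heq]
          exact hy
      have key := HolomorphicChain.integral_image_section_eq hq Tt hK₀ (𝔩₁ n) hWt hst hℓst hstW hopent
        e'.orthonormal (fun _ ↦ γ) (fun _ ↦ (1 : ℂ)) (h𝔖t n t) (fun x hx ↦ h𝔖W n hx)
      simp only [one_mul] at key
      rw [← himg n, HolomorphicChain.slice_image_section_eq (𝔩 n) (hℓ₂ n) (hSP n).2.2.2.2.1 (h𝔖W n) t,
        key]
      refine setIntegral_congr_fun (h𝔖t n t) fun x hx ↦ ?_
      congr 1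
      funext i
      exact (hDst x (h𝔖W n hx) _).symm
    calc ∑' n, Fn n t
        = ∑' n, g t * ∫ x in {x : E₁ | toLp 2 (x, t) ∈ B n}, γ (Tt.orientationFrame x)
            ∂(μHE[2 * q] : Measure E₁) := tsum_congr fun n ↦ by rw [hFn' n, hFn'' n]
      _ = g t * ∑' n, ∫ x in {x : E₁ | toLp 2 (x, t) ∈ B n}, γ (Tt.orientationFrame x)
            ∂(μHE[2 * q] : Measure E₁) := tsum_mul_left
      _ = g t * ∫ x in Ut, γ (Tt.orientationFrame x) ∂(μHE[2 * q] : Measure E₁) := by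
          rw [integral_iUnion hBt_m hBt_d (hintt.mono_set hUV)]
      _ = g t * ∫ x in Vt, γ (Tt.orientationFrame x) ∂(μHE[2 * q] : Measure E₁) := by
          rw [setIntegral_congr_set hUVae]
      _ = g t * analyticCyclePeriod Φ₁ hZt γ := by rw [(analyticCyclePeriod_eq_setIntegral Φ₁ hZt γ).symm]
  refine ⟨fun _ ↦ hsum_int.congr hfib, ?_⟩
  rw [hLHS]
  simp_rw [hpiece]
  rw [tsum_mul_left]
  congr 1
  rw [← integral_tsum hF_meas hF_sum]
  exact integral_congr_ae hfib

open Classical in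
/-- **The weighted fibre formula (coarea over the second factor) for the analytic cycle class of a
product torus.** Let `Z ⊆ X₁ × X₂` be analytic of pure dimension `q + dim E₂` with `0 < q`, `γ` an
invariant `2q`-form of `X₁`, `ν` an invariant form of `X₂` of top degree `2 dim E₂`, and `g : E₂ → ℂ` a
bounded measurable weight vanishing off a ball. Then, over the slab `Φ₁([0,1)^ι₁) × E₂`,
`∫_{reg π⁻¹Z ∩ (Φ₁([0,1)^ι₁) × E₂)} g(z₂) (pr₁^*γ ∧ pr₂^*ν)(ξ(z)) d𝓗 = ν(e₂, ie₂, …) · ∫_{t ∈ E₂} g(t) (∫_{Z_t} γ) d𝓗^{2 dim E₂}(t)`,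
where `Z_t = {x̄ | (x̄, π₂ t) ∈ Z}` is the slice (for a.e. `t` empty — contributing `0` — or of pure
dimension `q`, `ae_hasPureDim_fibreSlice`): the slicing identity `⟨[Z], pr₂, t⟩ = [Z_t]` for almost
all `t`, tested against `pr₁^*γ` and the weight `g`. [cite: Federer1969, 3.2.22 (coarea formula) and
4.3.2 (slicing)] [cite: King1971, §3] [cite: Chirka1989, §14.1 Cor., p. 174] [cite: VoisinHodgeI2002, §11.1.2] -/
theorem setIntegral_weight_cross_eq_integral_fibreSlice {q : ℕ} (hq : 0 < q)
    {Z : Set (ComplexTorus (prodPeriodL2 Φ₁ Φ₂))}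
    (hZ : HasPureDim 𝓘(ℂ, WithLp 2 (E₁ × E₂)) Z (q + finrank ℂ E₂))
    (γ : E₁ [⋀^Fin (2 * q)]→L[ℝ] ℂ) (ν : E₂ [⋀^Fin (2 * finrank ℂ E₂)]→L[ℝ] ℂ)
    (h2 : 2 * q + 2 * finrank ℂ E₂ = 2 * (q + finrank ℂ E₂))
    (e₂ : OrthonormalBasis (Fin (finrank ℂ E₂)) ℂ E₂)
    {g : E₂ → ℂ} (hgm : Measurable g) {M : ℝ} (hgM : ∀ t, ‖g t‖ ≤ M) {R : ℝ}
    (hgR : ∀ t, g t ≠ 0 → ‖t‖ ≤ R) :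
    ∫ z in (analyticChain (prodPeriodL2 Φ₁ Φ₂) hZ).carrier ∩
        {z : WithLp 2 (E₁ × E₂) | (ofLp z).1 ∈ periodBox Φ₁ 0},
        g (ofLp z).2 * ((((γ.compContinuousLinearMap (ContinuousLinearMap.fst ℝ E₁ E₂)).wedge
            (ν.compContinuousLinearMap (ContinuousLinearMap.snd ℝ E₁ E₂))).domDomCongr
          (finCongr h2)).compContinuousLinearMap
          (WithLp.prodContinuousLinearEquiv 2 ℝ E₁ E₂ : WithLp 2 (E₁ × E₂) →L[ℝ] E₁ × E₂))
          ((analyticChain (prodPeriodL2 Φ₁ Φ₂) hZ).orientationFrame z)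
        ∂(μHE[2 * (q + finrank ℂ E₂)] : Measure (WithLp 2 (E₁ × E₂))) =
      ν (complexFrame ⇑e₂) * ∫ t, g t *
        (if h : HasPureDim 𝓘(ℂ, E₁)
            {x : ComplexTorus Φ₁ | (prodHomeomorphL2 Φ₁ Φ₂).symm (x, cover Φ₂ t) ∈ Z} q
          then analyticCyclePeriod Φ₁ h γ else 0) ∂(μHE[2 * finrank ℂ E₂] : Measure E₂) :=
  (weight_cross_core Φ₁ Φ₂ hq hZ γ ν h2 e₂ hgm hgM hgR).2

open Classical in
/-- **Integrability of the weighted fibre period**: in the setting of the weighted fibre formula, if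
`ν(e₂, ie₂, …) ≠ 0` for some invariant top form `ν` of `X₂` (e.g. a volume form), then
`t ↦ g(t) ∫_{Z_t} γ` is `𝓗^{2 dim E₂}`-integrable on `E₂` (the fibre integrals of the pieces are summable
in `L¹`, by the `∫⁻` form of the local coarea formula and Lelong's bound on the bounded window).
[cite: Federer1969, 3.2.22 and 3.2.23] [cite: King1971, §3] -/
theorem integrable_weight_mul_fibreSlicePeriod {q : ℕ} (hq : 0 < q)
    {Z : Set (ComplexTorus (prodPeriodL2 Φ₁ Φ₂))}
    (hZ : HasPureDim 𝓘(ℂ, WithLp 2 (E₁ × E₂)) Z (q + finrank ℂ E₂))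
    (γ : E₁ [⋀^Fin (2 * q)]→L[ℝ] ℂ) {ν : E₂ [⋀^Fin (2 * finrank ℂ E₂)]→L[ℝ] ℂ}
    {e₂ : OrthonormalBasis (Fin (finrank ℂ E₂)) ℂ E₂} (hν : ν (complexFrame ⇑e₂) ≠ 0)
    {g : E₂ → ℂ} (hgm : Measurable g) {M : ℝ} (hgM : ∀ t, ‖g t‖ ≤ M) {R : ℝ}
    (hgR : ∀ t, g t ≠ 0 → ‖t‖ ≤ R) :
    Integrable (fun t ↦ g t *
        (if h : HasPureDim 𝓘(ℂ, E₁)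
            {x : ComplexTorus Φ₁ | (prodHomeomorphL2 Φ₁ Φ₂).symm (x, cover Φ₂ t) ∈ Z} q
          then analyticCyclePeriod Φ₁ h γ else 0)) (μHE[2 * finrank ℂ E₂] : Measure E₂) :=
  (weight_cross_core Φ₁ Φ₂ hq hZ γ ν (by ring) e₂ hgm hgM hgR).1 hν

open Classical in
/-- **The fibre period `t ↦ ∫_{Z_t} γ` is integrable on every ball** (given a top form `ν` of `X₂` with
`ν(e₂, ie₂, …) ≠ 0`): the weight `1_{B̄(0,R)}`. [cite: Federer1969, 3.2.22 and 3.2.23] [cite: King1971, §3] -/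
theorem integrableOn_fibreSlicePeriod_closedBall {q : ℕ} (hq : 0 < q)
    {Z : Set (ComplexTorus (prodPeriodL2 Φ₁ Φ₂))}
    (hZ : HasPureDim 𝓘(ℂ, WithLp 2 (E₁ × E₂)) Z (q + finrank ℂ E₂))
    (γ : E₁ [⋀^Fin (2 * q)]→L[ℝ] ℂ) {ν : E₂ [⋀^Fin (2 * finrank ℂ E₂)]→L[ℝ] ℂ}
    {e₂ : OrthonormalBasis (Fin (finrank ℂ E₂)) ℂ E₂} (hν : ν (complexFrame ⇑e₂) ≠ 0) (R : ℝ) :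
    IntegrableOn (fun t ↦
        (if h : HasPureDim 𝓘(ℂ, E₁)
            {x : ComplexTorus Φ₁ | (prodHomeomorphL2 Φ₁ Φ₂).symm (x, cover Φ₂ t) ∈ Z} q
          then analyticCyclePeriod Φ₁ h γ else 0)) (Metric.closedBall (0 : E₂) R)
      (μHE[2 * finrank ℂ E₂] : Measure E₂) := by
  have h := integrable_weight_mul_fibreSlicePeriod Φ₁ Φ₂ hq hZ γ hν
    (g := (Metric.closedBall (0 : E₂) R).indicator fun _ ↦ (1 : ℂ))
    (measurable_const.indicator measurableSet_closedBall) (M := 1)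
    (fun t ↦ by
      by_cases ht : t ∈ Metric.closedBall (0 : E₂) R
      · rw [indicator_of_mem ht, norm_one]
      · rw [indicator_of_notMem ht, norm_zero]; exact zero_le_one)
    (R := R) (fun t ht ↦ by
      by_contra h
      exact ht (indicator_of_notMem (fun h' ↦ h (mem_closedBall_zero_iff.1 h')) _))
  rw [← integrable_indicator_iff measurableSet_closedBall]
  refine h.congr (ae_of_all _ fun t ↦ ?_)
  by_cases ht : t ∈ Metric.closedBall (0 : E₂) R
  · simp only [indicator_of_mem ht, one_mul]
  · simp only [indicator_of_notMem ht, zero_mul]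

open Classical in
/-- **The fibre period `t ↦ ∫_{Z_t} γ` is a.e. strongly measurable** (given a top form `ν` of `X₂` with
`ν(e₂, ie₂, …) ≠ 0`): it is integrable on every ball. [cite: Federer1969, 3.2.22 and 3.2.23] [cite: King1971, §3] -/
theorem aestronglyMeasurable_fibreSlicePeriod {q : ℕ} (hq : 0 < q)
    {Z : Set (ComplexTorus (prodPeriodL2 Φ₁ Φ₂))}
    (hZ : HasPureDim 𝓘(ℂ, WithLp 2 (E₁ × E₂)) Z (q + finrank ℂ E₂))
    (γ : E₁ [⋀^Fin (2 * q)]→L[ℝ] ℂ) {ν : E₂ [⋀^Fin (2 * finrank ℂ E₂)]→L[ℝ] ℂ}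
    {e₂ : OrthonormalBasis (Fin (finrank ℂ E₂)) ℂ E₂} (hν : ν (complexFrame ⇑e₂) ≠ 0) :
    AEStronglyMeasurable (fun t ↦
        (if h : HasPureDim 𝓘(ℂ, E₁)
            {x : ComplexTorus Φ₁ | (prodHomeomorphL2 Φ₁ Φ₂).symm (x, cover Φ₂ t) ∈ Z} q
          then analyticCyclePeriod Φ₁ h γ else 0)) (μHE[2 * finrank ℂ E₂] : Measure E₂) := by
  set F : E₂ → ℂ := fun t ↦
    (if h : HasPureDim 𝓘(ℂ, E₁)
        {x : ComplexTorus Φ₁ | (prodHomeomorphL2 Φ₁ Φ₂).symm (x, cover Φ₂ t) ∈ Z} q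
      then analyticCyclePeriod Φ₁ h γ else 0) with hF
  -- `F` is the pointwise limit of its truncations to the balls `B̄(0, n)`
  have hlim : ∀ t, Tendsto (fun n : ℕ ↦ (Metric.closedBall (0 : E₂) n).indicator F t) atTop (𝓝 (F t)) := by
    intro t
    obtain ⟨n₀, hn₀⟩ := exists_nat_ge ‖t‖
    refine tendsto_const_nhds.congr' ?_
    filter_upwards [eventually_ge_atTop n₀] with n hn
    rw [indicator_of_mem]
    exact mem_closedBall_zero_iff.2 (hn₀.trans (Nat.cast_le.2 hn))
  refine aestronglyMeasurable_of_tendsto_ae atTop (fun n ↦ ?_) (ae_of_all _ hlim)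
  exact ((integrable_indicator_iff measurableSet_closedBall).2
    (integrableOn_fibreSlicePeriod_closedBall Φ₁ Φ₂ hq hZ γ hν n)).aestronglyMeasurable

end Fibre

end ComplexTorus

end Literature.Geometry.Kaehler

end
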